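import Literature.NumberTheory.Automorphic.IdeleClassCharacterConjugate
import Literature.RepresentationTheory.HarrisKudlaSweet1996.SplittingCharactersCM
import Literature.NumberTheory.GaloisRepresentations.CMTypeHeckeCharacter
import Literature.NumberTheory.GaloisRepresentations.CharacterPrescribedLocalComponentsProofs
import Literature.NumberTheory.GaloisRepresentations.AlgebraicHeckeCharacterGrossencharakterProofs
import Literature.NumberTheory.GaloisRepresentations.IdelicLocalNorm
import Literature.NumberTheory.GelbartRogawski1991.CMSplittingCharLocalMu
import Literature.NumberTheory.Automorphic.UnitaryGroupNonsplitPlace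
import Literature.NumberTheory.Automorphic.Liu2021.LemD1DataOfPlace
import Literature.NumberTheory.Automorphic.Liu2021.LemD1AsPrintedIndexedNonVacuityTameTwist
import Literature.NumberTheory.Automorphic.Liu2021.LemD1AsPrintedIndexedNonVacuityInertRigidity
import HarnessLib

/-!
# [Liu2021, App. D §D.1 Step 2 ∕ Lemma D.1 (3); Def. 4.1, 4.3, 4.11] — the TAME TWIST, GLOBALISED: two conjugate symplectic
# characters of the SAME ∞-type whose μ-labels `localMu L (toHeckeCharacter L ·) v` DIFFER at a PRESCRIBED non-split place `v ∤ 2`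

Reproduction ∕ bookkeeping (Literature, THEOREMS ONLY: no definition, no record, no named fact, no `sorry`; nothing is
asserted about Liu's oscillator representations or about the tree's constructed local Weil carriers).

Sequel of `LemD1AsPrintedIndexedNonVacuityTameTwist.lean` (the local tame character `θ_w` at a place `w ∤ 2`: finite order, open
kernel, `θ_w(−1) ≠ 1`; the place-model twist) and of `…InertRigidity.lean` ∕ `…InertCofinite.lean` (for conjugate symplectic `ψ, ψ'`
UNRAMIFIED above an inert `v` the labels `localMu L (toHeckeCharacter L ψ) v`, `localMu L (toHeckeCharacter L ψ') v` COINCIDE; they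
coincide at all but finitely many non-split `v`).  This file shows that the coincidence is NOT automatic at any single non-split place:
the displayed `hD3` family ([Liu2021, Lem. D.1 (3)] AS PRINTED read on the rows' own indexed data, members indexed by the conjugate
symplectic characters `ψ` of [Def. 4.1]) contains, for every member `ψ` and every PRESCRIBED non-split place `v ∤ 2` of `L⁺`, a member
`ψ'` of the SAME ∞-type (hence the same weight and CM type, [Def. 4.3]) whose μ-label at `v` differs from that of `ψ`.

* §1 bookkeeping: `toHeckeCharacter` and `localMu` are multiplicative (`toHeckeCharacter_mul/inv`, `localMu_mul/inv`); a Hecke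
  character of FINITE ORDER of the (totally complex) CM field `L` is trivial on the infinite idèles
  (`apply_infiniteIdeles_eq_one_of_isFiniteOrder`: every infinite idèle is an `n`-th power, tree `InfiniteIdele.exists_pow_eq_tendsto_one`).
* §2 **`exists_twist_of_isFiniteOrder`**: for a finite-order Hecke character `θ` of `L` and a conjugate symplectic `ψ` of ∞-type `e`,
  `ψ' := ψ · θ̃ · (θ̃ ∘ c)⁻¹` (`θ̃ = unitaryClassChar θ`, `θ̃ ∘ c = galConj c θ̃`, [Liu2021, §4.1 «`μ^c ≔ μ ∘ c`»]) is conjugate symplectic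
  (`c` fixes the classes from `L⁺`, tree `classGalAct_classBaseChange`) of ∞-type `e` (`θ̃` and `θ̃ ∘ c` kill the infinite idèle classes), with
  Hecke character `toHeckeCharacter ψ · θ · (θ ∘ c)⁻¹`; **`localMu_mul_twist_apply`**: at a place `w ∣ v` FIXED by `c`,
  `localMu L (χ · θ · (θ ∘ c)⁻¹) v x = localMu L χ v x · θ_w(x_w · (c_w x_w)⁻¹)` (`c • ⟨u⟩_w = ⟨c_w u⟩_w`, tree `algEquiv_smul_localUnits`).
* §3 **`exists_heckeCharacter_isFiniteOrder_tame`**: at a place `w ∤ 2` of `L` there is a finite-order Hecke character `θ` whose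
  component `θ_w` is trivial on `1 + 𝔭_w` with `θ_w(−1) = −1` — [ClozelHarrisTaylor2008, Lem. 4.1.1] (tree, idelic form
  `exists_heckeCharacter_isFiniteOrder_localComponent_eq`) applied to the tame character of the prequel.
* §4 **`exists_isConjugateSymplectic_localMu_apply_eps_eq_neg`** (MAIN): for `v ∤ 2`, `w ∣ v` with `c • w = w`, and a conjugate
  symplectic `ψ` of ∞-type `e`, there is a conjugate symplectic `ψ'` of ∞-type `e` with
  `localMu L (toHeckeCharacter L ψ') v (ε) = −localMu L (toHeckeCharacter L ψ) v (ε)` at `ε = δ ⊗ 1` (`δ = imagUnit L`, `c δ = −δ`, so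
  `ε_w · (c_w ε_w)⁻¹ = −1` and the twist contributes `θ_w(−1) = −1`); in particular the two μ-labels are DIFFERENT.
* §5 consequences: weight ∕ CM-type forms (`exists_isConjugateSymplectic_hasWeight_localMu_ne`, `…hasCMType…`), a pair of weight-one
  members with different labels (`exists_pair_isConjugateSymplectic_hasWeight_one_localMu_ne`), the packaged `LemD1OfPlace.muOf` labels
  differ with VERBATIM the rows' displayed proofs (`exists_isConjugateSymplectic_muOf_localMu_ne`), the companion is RAMIFIED above `v`
  whenever `ψ` is unramified there and `v` carries an inert witness (`not_isUnramifiedAt_of_localMu_ne`, by `…InertRigidity`), and the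
  consumer-shaped reading `not_areIsomorphicRep_of_lemD1_3AsPrintedI`: on ANY indexed collection over the rows' standing data at `v`
  carrying the labels of `ψ` and `ψ'`, [Lem. D.1 (3)] AS PRINTED forces the two `ω`'s to be NON-isomorphic — at a non-split place
  the μ-conjunct of the `hD3` row is a genuine DUTY on the rows' carriers, not void.

* §6 (v2) the SPLIT places: **`exists_heckeCharacter_isFiniteOrder_tame_and_trivial`** (CHT 4.1.1 at `S = {w, w'}`: `θ_w` tame with
  `θ_w(−1) = −1`, `θ_{w'} = 1`), **`localMu_mul_twist_apply_single`** (the twist on a unit concentrated at one place),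
  **`exists_isConjugateSymplectic_localMu_apply_single_eq_neg_of_split`** (at a SPLIT `v ∤ 2`: a companion `ψ'` of the same ∞-type with
  `localMu ψ' v (z) = −localMu ψ v (z)` at `z = (−1 at w, 1 at c w)`), and the SYNTHESIS **`exists_isConjugateSymplectic_localMu_ne`** ∕
  `exists_isConjugateSymplectic_muOf_localMu_ne'`: at EVERY place `v ∤ 2` of `L⁺` — split, inert or ramified — every member `ψ` has a
  companion of the same ∞-type with a DIFFERENT μ-label at `v`.

What this does NOT give (v1 excluded the split places; v2 covers them, §6): places above `2`; that the companion differs from `ψ` ONLY above `v` (the finite-order `θ` of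
[ClozelHarrisTaylor2008, 4.1.1] is uncontrolled away from `w`); anything about the rows' carriers `𝓢.omegaLoc v` or `χ_v`; Lem. D.1
itself.  HC_CM is NOT proved.

Cell pub-hodgecm2 (COR-CM), audit class of the END rows `hD1''` ∕ `hD3`; seat prover-pub-hodgecm2-b10.

References: [Liu2021] Y. Liu, *Fourier–Jacobi cycles and arithmetic relative trace formula*, Camb. J. Math. 9 (2021) =
arXiv:2102.11518, §4.1 Def. 4.1 (`FJcycle.tex` l. 1900–1902), after Remark 4.2 (l. 1912, «`μ^c ≔ μ ∘ c`»), Remark 4.4 (l. 1930–1933),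
Def. 4.3, Def. 4.11 (l. 2086), App. D §D.1 Steps 1–2 (l. 5217–5219), Lemma D.1 (3) (l. 5233); [ClozelHarrisTaylor2008] L. Clozel,
M. Harris, R. Taylor, Publ. Math. IHÉS 108 (2008), Lemma 4.1.1 (p. 116); [NeukirchANT1999] J. Neukirch, *Algebraic Number Theory*
(1999), Ch. VII §6 (6.9) (characters of finite order), Ch. II §5 Prop. (5.3); [CasselsFrohlichANT1967] Ch. II §10, Ch. VII §1.1
(the Galois action on completions and local idèles); [WeilBNT1967] A. Weil, *Basic Number Theory*, Ch. VII §3.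
-/

noncomputable section

open scoped Matrix MatrixGroups
open NumberField IsDedekindDomain
open Literature.NumberTheory.GaloisRepresentations (HeckeCharacter ideleGroup localUnits infiniteIdeles)
open Literature.NumberTheory.Automorphic.IdeleClassGroup (toHeckeCharacter isUnitary_toHeckeCharacter IsConjugateSymplectic
  HasInfinityType HasWeight HasCMType galConj classGalAct coe_toHeckeCharacter_apply galConj_apply classGalAct_classBaseChange
  classGalAct_infUnitsToClass)
open Literature.RepresentationTheory.HarrisKudlaSweet1996 (unitaryClassChar toHeckeCharacter_unitaryClassChar coe_unitaryClassChar_mk)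

namespace Literature.NumberTheory.Automorphic.Liu2021.LemD1IndexedNonVacuityTameTwistCM

open UnitaryGroup

variable (L : Type) [Field L] [NumberField L] [IsCMField L]

local notation3 "cc" => (IsCMField.complexConj L)
local notation3 "L⁺" => (↥(maximalRealSubfield L))

/-! ## §1 Bookkeeping: products of class characters, `localMu` of a product, the Galois action on local idèles -/

omit [IsCMField L] in
/-- `toHeckeCharacter` is multiplicative: the Hecke character of `ψ · η` is the product of the Hecke characters. [cite: WeilBNT1967, Ch. VII §3] -/
theorem toHeckeCharacter_mul (ψ η : IdeleClassGroup L →ₜ* Circle) :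
    toHeckeCharacter L (ψ * η) = toHeckeCharacter L ψ * toHeckeCharacter L η :=
  HeckeCharacter.ext fun x => Units.ext (by
    rw [coe_toHeckeCharacter_apply, HeckeCharacter.mul_apply, Units.val_mul, coe_toHeckeCharacter_apply,
      coe_toHeckeCharacter_apply, ContinuousMonoidHom.mul_apply, Circle.coe_mul])

omit [IsCMField L] in
/-- `localMu` ([Liu2021, Def. 4.11] «`μ = ⊗ μ_v`») is multiplicative in the Hecke character: `(χ₁ χ₂)_v = (χ₁)_v (χ₂)_v`.
[cite: Liu2021, Def. 4.11 (l. 2086)] -/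
theorem localMu_mul (χ₁ χ₂ : HeckeCharacter L) (v : HeightOneSpectrum (𝓞 L⁺)) :
    GelbartRogawski1991.UnitaryDualPair.LocalSplitting.localMu L (χ₁ * χ₂) v =
      GelbartRogawski1991.UnitaryDualPair.LocalSplitting.localMu L χ₁ v *
        GelbartRogawski1991.UnitaryDualPair.LocalSplitting.localMu L χ₂ v := by
  ext x
  simp only [MonoidHom.mul_apply, GelbartRogawski1991.UnitaryDualPair.LocalSplitting.localMu_apply,
    HeckeCharacter.mul_apply, Finset.prod_mul_distrib]

omit [IsCMField L] in
/-- the Galois action on a local idèle at a place `w` moved to `w'`: `σ • ⟨x⟩_w = ⟨σ x⟩_{w'}` (tree `algEquiv_smul_localUnits`, with the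
target place as a variable). [cite: CasselsFrohlichANT1967, Ch. VII §1.1] -/
private theorem smul_localUnits_eq (σ : L ≃ₐ[L⁺] L) {w w' : HeightOneSpectrum (𝓞 L)} (h : σ • w = w')
    (x : (w.adicCompletion L)ˣ) : σ • localUnits w x = localUnits w' (galAdicCompletionUnitsEquiv (L := L) σ h x) := by
  subst h
  exact GaloisRepresentations.algEquiv_smul_localUnits L⁺ L σ w x

/-- **a Hecke character of FINITE ORDER of the CM field `L` is trivial on the infinite idèles** (`L` is totally complex: every
infinite idèle `y` is an `n`-th power, `y = zⁿ`, tree `InfiniteIdele.exists_pow_eq_tendsto_one`; `θ(y) = θ(z)ⁿ = θⁿ(z) = 1`).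
[cite: NeukirchANT1999, Ch. VII §6 (6.9)] -/
theorem apply_infiniteIdeles_eq_one_of_isFiniteOrder {θ : HeckeCharacter L} (hθ : θ.IsFiniteOrder)
    (y : (InfiniteAdeleRing L)ˣ) : θ (infiniteIdeles L y) = 1 := by
  obtain ⟨n, hn, hθn⟩ := hθ.exists_pow_eq_one
  have hy : GaloisRepresentations.InfiniteIdele.IsTotallyPositive y := fun w hw =>
    absurd hw (InfinitePlace.not_isReal_iff_isComplex.mpr (IsTotallyComplex.isComplex w))
  obtain ⟨z, hz, -⟩ := GaloisRepresentations.InfiniteIdele.exists_pow_eq_tendsto_one y hy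
  rw [← hz n hn, map_pow, map_pow, ← HeckeCharacter.pow_apply, hθn, HeckeCharacter.one_apply]

omit [IsCMField L] in
/-- inverses of circle-valued class characters are pointwise (definitional). [folklore] -/
private theorem inv_apply' (ψ : IdeleClassGroup L →ₜ* Circle) (x : IdeleClassGroup L) : ψ⁻¹ x = (ψ x)⁻¹ := rfl

omit [IsCMField L] in
/-- `toHeckeCharacter` of an inverse is the inverse Hecke character. [cite: WeilBNT1967, Ch. VII §3] -/
theorem toHeckeCharacter_inv (ψ : IdeleClassGroup L →ₜ* Circle) :
    toHeckeCharacter L ψ⁻¹ = (toHeckeCharacter L ψ)⁻¹ :=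
  HeckeCharacter.ext fun x => Units.ext (by
    rw [coe_toHeckeCharacter_apply, HeckeCharacter.inv_apply, Units.val_inv_eq_inv_val, coe_toHeckeCharacter_apply,
      inv_apply', Circle.coe_inv])

omit [IsCMField L] in
/-- `localMu` of an inverse: `(χ⁻¹)_v = (χ_v)⁻¹`. [cite: Liu2021, Def. 4.11 (l. 2086)] -/
theorem localMu_inv (χ : HeckeCharacter L) (v : HeightOneSpectrum (𝓞 L⁺)) :
    GelbartRogawski1991.UnitaryDualPair.LocalSplitting.localMu L χ⁻¹ v =
      (GelbartRogawski1991.UnitaryDualPair.LocalSplitting.localMu L χ v)⁻¹ := by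
  ext x
  simp only [MonoidHom.inv_apply, GelbartRogawski1991.UnitaryDualPair.LocalSplitting.localMu_apply,
    HeckeCharacter.inv_apply, Finset.prod_inv_distrib]

variable (v : HeightOneSpectrum (𝓞 (maximalRealSubfield L)))

/-- at a non-split place (`w` the only place above `v`, tree `PlacesOver.prod_eq_of_smul_eq`) `μ_v(x) = χ(⟨x_w⟩_w) = χ_w(x_w)`.
[cite: Liu2021, Def. 4.11 (l. 2086)] [cite: CasselsFrohlichANT1967, Ch. II §10] -/
private theorem localMu_apply_of_smul_eq (χ : HeckeCharacter L) (w : PlacesOver L v) (hw : cc • w.1 = w.1) (x : (LocalRing L v)ˣ) :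
    GelbartRogawski1991.UnitaryDualPair.LocalSplitting.localMu L χ v x =
      χ (localUnits w.1 (Units.map (Pi.evalMonoidHom (fun w : PlacesOver L v => w.1.adicCompletion L) w) x)) := by
  rw [GelbartRogawski1991.UnitaryDualPair.LocalSplitting.localMu_apply,
    PlacesOver.prod_eq_of_smul_eq cc (IsCMField.complexConj_ne_one L) w hw]

/-! ## §2 The twist `η = θ̃ · (θ̃ ∘ c)⁻¹` by a finite-order Hecke character `θ` and the character `ψ' = ψ · η` -/

/-- **the conjugate-orthogonal finite-order twist**: for a Hecke character `θ` of `L` of finite order and a conjugate symplectic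
`ψ` ([Liu2021, Def. 4.1]) of ∞-type `e`, the character `ψ' := ψ · θ̃ · (θ̃ ∘ c)⁻¹` (`θ̃ = unitaryClassChar θ` the circle-valued class
character of `θ`, `θ̃ ∘ c = galConj c θ̃`, Liu's «`μ^c ≔ μ ∘ c`») is again conjugate symplectic (`θ̃ · (θ̃ ∘ c)⁻¹` is trivial on the classes
from `L⁺`, which `c` fixes) of the SAME ∞-type `e` (`θ̃` and `θ̃ ∘ c` kill the infinite idèle classes, §1), and its Hecke character is
`toHeckeCharacter ψ · θ · (θ ∘ c)⁻¹`. [cite: Liu2021, Def. 4.1 (l. 1900–1902), §4.1 (l. 1912) and Remark 4.4 (l. 1930–1933)] -/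
theorem exists_twist_of_isFiniteOrder {θ : HeckeCharacter L} (hθ : θ.IsFiniteOrder) (ψ : IdeleClassGroup L →ₜ* Circle)
    (hψ : IsConjugateSymplectic L ψ) {e : InfinitePlace L → ℤ} (he : HasInfinityType L ψ e) :
    ∃ ψ' : IdeleClassGroup L →ₜ* Circle, IsConjugateSymplectic L ψ' ∧ HasInfinityType L ψ' e ∧
      toHeckeCharacter L ψ' = toHeckeCharacter L ψ * (θ * (HeckeCharacter.galConj cc θ)⁻¹) := by
  set θc : IdeleClassGroup L →ₜ* Circle := unitaryClassChar L θ hθ.isUnitary with hθc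
  have hθc1 : ∀ y : (InfiniteAdeleRing L)ˣ, θc (infUnitsToClass L y) = 1 := fun y => by
    apply Circle.ext
    rw [infUnitsToClass_apply, hθc, coe_unitaryClassChar_mk,
      apply_infiniteIdeles_eq_one_of_isFiniteOrder L hθ y, Units.val_one, Circle.coe_one]
  refine ⟨ψ * (θc * (galConj cc θc)⁻¹), fun a => ?_, fun y => ?_, ?_⟩
  · rw [ContinuousMonoidHom.mul_apply, ContinuousMonoidHom.mul_apply, inv_apply', galConj_apply,
      classGalAct_classBaseChange, mul_inv_cancel, mul_one]
    exact hψ a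
  · rw [ContinuousMonoidHom.mul_apply, ContinuousMonoidHom.mul_apply, inv_apply', galConj_apply,
      classGalAct_infUnitsToClass, hθc1, hθc1, inv_one, mul_one, mul_one]
    exact he y
  · rw [toHeckeCharacter_mul, toHeckeCharacter_mul, toHeckeCharacter_inv, IdeleClassGroup.toHeckeCharacter_galConj, hθc,
      toHeckeCharacter_unitaryClassChar]

/-- **the local effect of the twist at a NON-SPLIT place**: for `w ∣ v` fixed by `c` and `x ∈ L_vˣ`,
`localMu L (χ · θ · (θ ∘ c)⁻¹) v x = localMu L χ v x · θ_w(x_w · (c_w x_w)⁻¹)` (`(θ ∘ c)(⟨u⟩_w) = θ(c • ⟨u⟩_w) = θ(⟨c_w u⟩_w)`).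
[cite: Liu2021, Def. 4.11 (l. 2086)] [cite: CasselsFrohlichANT1967, Ch. VII §1.1] -/
theorem localMu_mul_twist_apply (χ θ : HeckeCharacter L) (w : PlacesOver L v) (hw : cc • w.1 = w.1) (x : (LocalRing L v)ˣ) :
    GelbartRogawski1991.UnitaryDualPair.LocalSplitting.localMu L (χ * (θ * (HeckeCharacter.galConj cc θ)⁻¹)) v x =
      GelbartRogawski1991.UnitaryDualPair.LocalSplitting.localMu L χ v x *
        θ.localComponent w.1
          (Units.map (Pi.evalMonoidHom (fun w : PlacesOver L v => w.1.adicCompletion L) w) x *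
            (galAdicCompletionUnitsEquiv (L := L) cc hw
              (Units.map (Pi.evalMonoidHom (fun w : PlacesOver L v => w.1.adicCompletion L) w) x))⁻¹) := by
  rw [localMu_mul, localMu_mul, localMu_inv, MonoidHom.mul_apply, MonoidHom.mul_apply, MonoidHom.inv_apply,
    localMu_apply_of_smul_eq L v θ w hw, localMu_apply_of_smul_eq L v (HeckeCharacter.galConj cc θ) w hw,
    HeckeCharacter.galConj_apply, smul_localUnits_eq L cc hw, map_mul, map_inv, HeckeCharacter.localComponent_apply,
    HeckeCharacter.localComponent_apply]

/-! ## §3 A finite-order Hecke character of `L` whose component at a prescribed place `w ∤ 2` is TAME with `θ_w(−1) = −1` -/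

omit [IsCMField L] in
/-- **globalisation of the tame character** ([ClozelHarrisTaylor2008, Lem. 4.1.1] «there is a continuous character
`χ : Fˣ\\𝔸_Fˣ → ℚ̄ˣ` such that `χ|_{∏_{v∈S} F_vˣ} = χ_S`», in the tree's idelic form `exists_heckeCharacter_isFiniteOrder_localComponent_eq`,
at the one-element set `S = {w}`): at a place `w ∤ 2` of `L` there is a Hecke character `θ` of `L` of FINITE ORDER whose local component
`θ_w` is trivial on the principal units `1 + 𝔭_w` and has `θ_w(−1) = −1` (the tame character of the prequel: `θ_w(−1) ≠ 1` of square `1`).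
[cite: ClozelHarrisTaylor2008, Lemma 4.1.1 (p. 116)] [cite: NeukirchANT1999, Ch. II §5 Prop. (5.3)] -/
theorem exists_heckeCharacter_isFiniteOrder_tame (w : HeightOneSpectrum (𝓞 L)) (h2 : (2 : 𝓞 L) ∉ w.asIdeal) :
    ∃ θ : HeckeCharacter L, θ.IsFiniteOrder ∧
      (∀ x : (w.adicCompletion L)ˣ, Valued.v ((x : w.adicCompletion L) - 1) < 1 → θ.localComponent w x = 1) ∧
      θ.localComponent w (-1) = -1 := by
  classical
  obtain ⟨θw, hopen, hfin, -, hprin, hneg⟩ := LemD1IndexedNonVacuityTameTwist.exists_tame_character w h2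
  obtain ⟨θ, hθfin, hθw⟩ :=
    GaloisRepresentations.ClozelHarrisTaylor2008.exists_heckeCharacter_isFiniteOrder_localComponent_eq {w}
      (Function.update (fun w' : HeightOneSpectrum (𝓞 L) => (1 : (w'.adicCompletion L)ˣ →* ℂˣ)) w θw) (fun v hv => by
        rw [Finset.mem_singleton] at hv
        subst hv
        rw [Function.update_self]
        exact ⟨hopen, hfin⟩)
  have hw : θ.localComponent w = θw := by rw [hθw w (Finset.mem_singleton_self w), Function.update_self]
  have hsq : θw (-1) = -1 := by
    have h1 : θw (-1) ^ 2 = 1 := by rw [← map_pow, neg_one_sq, map_one]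
    have h2' : (((θw (-1) : ℂˣ) : ℂ)) ^ 2 = 1 := by rw [← Units.val_pow_eq_pow_val, h1, Units.val_one]
    rcases sq_eq_one_iff.1 h2' with h | h
    · exact absurd (Units.ext h) hneg
    · exact Units.ext (by rw [h, Units.val_neg, Units.val_one])
  exact ⟨θ, hθfin, fun x hx => by rw [hw]; exact hprin x hx, by rw [hw]; exact hsq⟩

/-! ## §4 Two members of the displayed `hD3` family with DIFFERENT μ-labels at a PRESCRIBED non-split place `v ∤ 2` -/

open Literature.NumberTheory.GelbartRogawski1991.UnitaryDualPair (imagUnit complexConj_imagUnit imagUnit_ne_zero)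
open Literature.NumberTheory.GelbartRogawski1991.UnitaryDualPair.LocalSplitting (localMu localMu_apply norm_localMu
  continuous_localMu localMu_toLocalRing_eq_one_iff)
open Literature.RepresentationTheory.Liu2021 (isOscillatorChar_toHeckeCharacter_iff)

/-- the `w`-component of `ε = δ ⊗ 1` times the inverse of its `c_w`-conjugate is `−1` (`c δ = −δ`, `c_w` extends `c`).
[cite: Liu2021, App. D §D.1 Step 1 (l. 5217)] [cite: CasselsFrohlichANT1967, Ch. VII §1.1] -/
private theorem eval_eps_mul_inv_conj (w : PlacesOver L v) (hw : cc • w.1 = w.1) :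
    Units.map (Pi.evalMonoidHom (fun w : PlacesOver L v => w.1.adicCompletion L) w) (LemD1OfPlace.eps L v (imagUnit_ne_zero L)) *
        (galAdicCompletionUnitsEquiv (L := L) cc hw
          (Units.map (Pi.evalMonoidHom (fun w : PlacesOver L v => w.1.adicCompletion L) w)
            (LemD1OfPlace.eps L v (imagUnit_ne_zero L))))⁻¹ = -1 := by
  rw [mul_inv_eq_iff_eq_mul, neg_one_mul]
  apply Units.ext
  rw [Units.val_neg]
  change ((imagUnit L : L) : w.1.adicCompletion L) =
    -galAdicCompletionMap cc hw ((imagUnit L : L) : w.1.adicCompletion L)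
  rw [galAdicCompletionMap_coe, AlgEquiv.smul_def, complexConj_imagUnit]
  have hc : ∀ x : L, ((x : L) : w.1.adicCompletion L) = algebraMap L (w.1.adicCompletion L) x := fun x => by
    rw [HeightOneSpectrum.algebraMap_adicCompletion]; rfl
  rw [hc, hc, map_neg, neg_neg]

/-- **MAIN — two conjugate symplectic characters of the SAME ∞-type whose μ-labels differ at a PRESCRIBED non-split place**: for a
place `v ∤ 2` of `L⁺`, `w ∣ v` fixed by complex conjugation, and a conjugate symplectic `ψ` ([Liu2021, Def. 4.1]) of ∞-type `e`, there is a
conjugate symplectic `ψ'` of ∞-type `e` with `localMu L (toHeckeCharacter L ψ') v (ε) = −localMu L (toHeckeCharacter L ψ) v (ε)` at Step 1's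
representative `ε = δ ⊗ 1` (`δ = imagUnit L`) — hence `localMu L (toHeckeCharacter L ψ') v ≠ localMu L (toHeckeCharacter L ψ) v`: the
μ-labels ([App. D §D.1 Step 2], `μ_v` of [Def. 4.11]) of the two members `ψ, ψ'` of the displayed `hD3` family DIFFER at `v`.
(`ψ' = ψ · θ̃ · (θ̃ ∘ c)⁻¹`, §2, for the finite-order `θ` of §3; at `ε` the twist contributes `θ_w(ε_w (c_w ε_w)⁻¹) = θ_w(−1) = −1`.)
[cite: Liu2021, App. D §D.1 Step 2 (l. 5219), Def. 4.1 (l. 1900–1902), Def. 4.11 (l. 2086)] [cite: ClozelHarrisTaylor2008, Lemma 4.1.1 (p. 116)] -/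
theorem exists_isConjugateSymplectic_localMu_apply_eps_eq_neg (h2 : (2 : 𝓞 L⁺) ∉ v.asIdeal) (w : PlacesOver L v)
    (hw : cc • w.1 = w.1) (ψ : IdeleClassGroup L →ₜ* Circle) (hψ : IsConjugateSymplectic L ψ) {e : InfinitePlace L → ℤ}
    (he : HasInfinityType L ψ e) :
    ∃ ψ' : IdeleClassGroup L →ₜ* Circle, IsConjugateSymplectic L ψ' ∧ HasInfinityType L ψ' e ∧
      localMu L (toHeckeCharacter L ψ') v (LemD1OfPlace.eps L v (imagUnit_ne_zero L)) =
        -localMu L (toHeckeCharacter L ψ) v (LemD1OfPlace.eps L v (imagUnit_ne_zero L)) ∧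
      localMu L (toHeckeCharacter L ψ') v ≠ localMu L (toHeckeCharacter L ψ) v := by
  obtain ⟨θ, hθfin, -, hθneg⟩ := exists_heckeCharacter_isFiniteOrder_tame L w.1
    (LemD1IndexedNonVacuityTameTwist.two_not_mem_of_placesOver L v w h2)
  obtain ⟨ψ', hψ', he', hH⟩ := exists_twist_of_isFiniteOrder L hθfin ψ hψ he
  have key : localMu L (toHeckeCharacter L ψ') v (LemD1OfPlace.eps L v (imagUnit_ne_zero L)) =
      -localMu L (toHeckeCharacter L ψ) v (LemD1OfPlace.eps L v (imagUnit_ne_zero L)) := by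
    rw [hH, localMu_mul_twist_apply L v _ θ w hw, eval_eps_mul_inv_conj L v w hw, hθneg, mul_neg, mul_one]
  refine ⟨ψ', hψ', he', key, fun h => ?_⟩
  rw [h] at key
  have := Units.ext_iff.1 key
  rw [Units.val_neg] at this
  exact (localMu L (toHeckeCharacter L ψ) v (LemD1OfPlace.eps L v (imagUnit_ne_zero L))).ne_zero
    (by linear_combination (1 : ℂ) / 2 * this)

/-! ## §5 Consequences: weight ∕ CM type preserved; packaged `muOf` labels differ; the twist is RAMIFIED at `w` when `ψ` is not;
what (3) AS PRINTED then demands of the rows' carriers -/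

/-- **weight form**: the companion `ψ'` may be taken of the same WEIGHT `𝔴` as `ψ` ([Liu2021, Def. 4.3]; in the rows: weight one).
[cite: Liu2021, Def. 4.3; App. D §D.1 Step 2 (l. 5219)] -/
theorem exists_isConjugateSymplectic_hasWeight_localMu_ne (h2 : (2 : 𝓞 L⁺) ∉ v.asIdeal) (w : PlacesOver L v)
    (hw : cc • w.1 = w.1) (ψ : IdeleClassGroup L →ₜ* Circle) (hψ : IsConjugateSymplectic L ψ) {𝔴 : InfinitePlace L → ℕ}
    (h𝔴 : HasWeight L ψ 𝔴) :
    ∃ ψ' : IdeleClassGroup L →ₜ* Circle, IsConjugateSymplectic L ψ' ∧ HasWeight L ψ' 𝔴 ∧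
      localMu L (toHeckeCharacter L ψ') v (LemD1OfPlace.eps L v (imagUnit_ne_zero L)) =
        -localMu L (toHeckeCharacter L ψ) v (LemD1OfPlace.eps L v (imagUnit_ne_zero L)) ∧
      localMu L (toHeckeCharacter L ψ') v ≠ localMu L (toHeckeCharacter L ψ) v := by
  obtain ⟨e, he, rfl⟩ := h𝔴
  obtain ⟨ψ', hψ', he', h1, h2'⟩ := exists_isConjugateSymplectic_localMu_apply_eps_eq_neg L v h2 w hw ψ hψ he
  exact ⟨ψ', hψ', ⟨e, he', rfl⟩, h1, h2'⟩

/-- **CM-type form**: the companion `ψ'` may be taken of the same CM TYPE `Φ` as `ψ` ([Liu2021, Def. 4.3]: same ∞-type).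
[cite: Liu2021, Def. 4.3; App. D §D.1 Step 2 (l. 5219)] -/
theorem exists_isConjugateSymplectic_hasCMType_localMu_ne (h2 : (2 : 𝓞 L⁺) ∉ v.asIdeal) (w : PlacesOver L v)
    (hw : cc • w.1 = w.1) (ψ : IdeleClassGroup L →ₜ* Circle) (hψ : IsConjugateSymplectic L ψ) {Φ : Literature.AlgebraicGeometry.Motives.CMType L}
    (hΦ : HasCMType L ψ Φ) :
    ∃ ψ' : IdeleClassGroup L →ₜ* Circle, IsConjugateSymplectic L ψ' ∧ HasCMType L ψ' Φ ∧
      localMu L (toHeckeCharacter L ψ') v (LemD1OfPlace.eps L v (imagUnit_ne_zero L)) =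
        -localMu L (toHeckeCharacter L ψ) v (LemD1OfPlace.eps L v (imagUnit_ne_zero L)) ∧
      localMu L (toHeckeCharacter L ψ') v ≠ localMu L (toHeckeCharacter L ψ) v := by
  obtain ⟨e, hne, he, rfl⟩ := hΦ
  obtain ⟨ψ', hψ', he', h1, h2'⟩ := exists_isConjugateSymplectic_localMu_apply_eps_eq_neg L v h2 w hw ψ hψ he
  exact ⟨ψ', hψ', ⟨e, hne, he', rfl⟩, h1, h2'⟩

/-- **two conjugate symplectic characters of weight one with different μ-labels at `v` exist** (no input `ψ`; a conjugate symplectic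
weight-one `ψ` exists on every CM field, `LemD1IndexedNonVacuityNonsplitPlace.exists_isConjugateSymplectic_hasWeight_one`) — at every place
`v ∤ 2` of `L⁺` fixed-above by `c`. [cite: Liu2021, Def. 4.1 (l. 1900–1902), Def. 4.3; App. D §D.1 Step 2 (l. 5219)] -/
theorem exists_pair_isConjugateSymplectic_hasWeight_one_localMu_ne (h2 : (2 : 𝓞 L⁺) ∉ v.asIdeal) (w : PlacesOver L v)
    (hw : cc • w.1 = w.1) :
    ∃ ψ ψ' : IdeleClassGroup L →ₜ* Circle, IsConjugateSymplectic L ψ ∧ HasWeight L ψ 1 ∧ IsConjugateSymplectic L ψ' ∧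
      HasWeight L ψ' 1 ∧ localMu L (toHeckeCharacter L ψ') v ≠ localMu L (toHeckeCharacter L ψ) v := by
  obtain ⟨ψ, hψ, hw1⟩ := LemD1IndexedNonVacuityNonsplitPlace.exists_isConjugateSymplectic_hasWeight_one L
  obtain ⟨ψ', hψ', hw1', -, hne⟩ := exists_isConjugateSymplectic_hasWeight_localMu_ne L v h2 w hw ψ hψ hw1
  exact ⟨ψ, ψ', hψ, hw1, hψ', hw1', hne⟩

variable (N : ℕ) (J : Matrix (Fin N) (Fin N) L) (hN : 2 ≤ N) (hJh : (J.map (IsCMField.complexConj L))ᵀ = J) (hJdet : J.det ≠ 0)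

/-- **the packaged `hD3` labels DIFFER at the prescribed place**: `LemD1OfPlace.muOf (localMu … ψ' …) ≠ LemD1OfPlace.muOf (localMu … ψ …)`,
each packaged with VERBATIM the rows' displayed side proofs `norm_localMu` ∕ `continuous_localMu` ∕
`localMu_toLocalRing_eq_one_iff … ((isOscillatorChar_toHeckeCharacter_iff _).mpr _)` — CONTRAST `LemD1IndexedNonVacuityInertRigidity.muOf_localMu_eq_of_inert_of_isUnramifiedAt`
(equal labels for members unramified above an inert `v`). [cite: Liu2021, App. D §D.1 Step 2 (l. 5219), Lemma D.1 (3) (l. 5233)] -/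
theorem exists_isConjugateSymplectic_muOf_localMu_ne (h2 : (2 : 𝓞 L⁺) ∉ v.asIdeal) (w : PlacesOver L v)
    (hw : cc • w.1 = w.1) (ψ : IdeleClassGroup L →ₜ* Circle) (hψ : IsConjugateSymplectic L ψ) {e : InfinitePlace L → ℤ}
    (he : HasInfinityType L ψ e) :
    ∃ (ψ' : IdeleClassGroup L →ₜ* Circle) (hψ' : IsConjugateSymplectic L ψ'), HasInfinityType L ψ' e ∧
      LemD1OfPlace.muOf L v cc N J (complexConj_imagUnit L) (imagUnit_ne_zero L) hN hJh hJdet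
          (localMu L (toHeckeCharacter L ψ') v)
          (fun x => norm_localMu L (toHeckeCharacter L ψ') v (isUnitary_toHeckeCharacter L ψ') x)
          (continuous_localMu L (toHeckeCharacter L ψ') v)
          (fun t => localMu_toLocalRing_eq_one_iff L (toHeckeCharacter L ψ') v
            ((isOscillatorChar_toHeckeCharacter_iff ψ').mpr hψ') t) ≠
        LemD1OfPlace.muOf L v cc N J (complexConj_imagUnit L) (imagUnit_ne_zero L) hN hJh hJdet
          (localMu L (toHeckeCharacter L ψ) v)
          (fun x => norm_localMu L (toHeckeCharacter L ψ) v (isUnitary_toHeckeCharacter L ψ) x)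
          (continuous_localMu L (toHeckeCharacter L ψ) v)
          (fun t => localMu_toLocalRing_eq_one_iff L (toHeckeCharacter L ψ) v
            ((isOscillatorChar_toHeckeCharacter_iff ψ).mpr hψ) t) := by
  obtain ⟨ψ', hψ', he', -, hne⟩ := exists_isConjugateSymplectic_localMu_apply_eps_eq_neg L v h2 w hw ψ hψ he
  exact ⟨ψ', hψ', he', fun h => hne (congrArg Subtype.val h)⟩

/-- **the companion is RAMIFIED above `v` whenever `ψ` is not**: at a place `w ∣ v` fixed by `c` with an inert witness `π`
(`v_w(ι_w π) = exp(−1)`), if `toHeckeCharacter ψ` is unramified at `w` and the labels of `ψ, ψ'` differ at `v`, then `toHeckeCharacter ψ'` is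
NOT unramified at `w` (`…InertRigidity`: unramified members have equal labels there).  So the second label costs ramification exactly at the
prescribed place. [cite: Liu2021, App. D §D.1 Step 2 (l. 5219); Def. 4.1] -/
theorem not_isUnramifiedAt_of_localMu_ne (w : PlacesOver L v) (hw : cc • w.1 = w.1) (π : (v.adicCompletion L⁺)ˣ)
    (hπ : Valued.v (toPlace v w (π : v.adicCompletion L⁺)) = WithZero.exp (-1 : ℤ)) (ψ ψ' : IdeleClassGroup L →ₜ* Circle)
    (hψ : IsConjugateSymplectic L ψ) (hψ' : IsConjugateSymplectic L ψ') (hunr : (toHeckeCharacter L ψ).IsUnramifiedAt w.1)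
    (hne : localMu L (toHeckeCharacter L ψ') v ≠ localMu L (toHeckeCharacter L ψ) v) :
    ¬ (toHeckeCharacter L ψ').IsUnramifiedAt w.1 := fun hunr' =>
  hne (LemD1IndexedNonVacuityInertRigidity.localMu_eq_localMu_of_inert_of_isUnramifiedAt L v ψ' ψ hψ' hψ w hw π hπ hunr' hunr)

omit [IsCMField L] in
/-- **what [Lem. D.1 (3)] AS PRINTED demands of the rows' carriers at `v`** (rank `N ≥ 3`): on ANY indexed collection `Lf` over the
place model at `v` and any two members `i, j` with DIFFERENT Step-2 labels (e.g. the labels of `ψ` and `ψ'` above), the displayed record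
`LemD1_3AsPrintedI Lf` forces `ω_j ≇ ω_i` — at a non-split place `v ∤ 2` the μ-conjunct of the `hD3` row is therefore a genuine duty on the
rows' carriers (two members of the family MUST carry non-isomorphic `ω(μ, ε, χ)` there), not a void clause.
[cite: Liu2021, App. D Lemma D.1 (3) (l. 5233)] -/
theorem not_areIsomorphicRep_of_lemD1_3AsPrintedI {ι : Type} (h3 : 3 ≤ N)
    (Lf : LemD1IndexedFamily (v.adicCompletion L⁺) (LocalRing L v) N ι)
    (hD3 : LemD1_3AsPrintedI Lf) {i j : ι} (hij : (Lf.mu j).1 ≠ (Lf.mu i).1) :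
    ¬ AreIsomorphicRep (Lf.quot j) (Lf.quot i) := fun hiso =>
  hij (hD3.mu_val_eq_of_areIsomorphicRep h3 hiso)

/-! ## §6 (v2) The SPLIT places: a finite-order `θ` prescribed at BOTH places above `v` (`θ_w` tame, `θ_{c w} = 1`), and the companion
`ψ'` whose μ-label differs from that of `ψ` at the unit `(−1 at w, 1 at c w)`; SYNTHESIS over all places `∤ 2` -/

omit [IsCMField L] in
/-- **a finite-order Hecke character with prescribed components at TWO places**: tame at `w ∤ 2` (`θ_w(−1) = −1`, trivial on `1 + 𝔭_w`) and
TRIVIAL at a second place `w' ≠ w` ([ClozelHarrisTaylor2008, Lem. 4.1.1] at `S = {w, w'}`). [cite: ClozelHarrisTaylor2008, Lemma 4.1.1 (p. 116)] -/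
theorem exists_heckeCharacter_isFiniteOrder_tame_and_trivial (w w' : HeightOneSpectrum (𝓞 L)) (hww' : w' ≠ w)
    (h2 : (2 : 𝓞 L) ∉ w.asIdeal) :
    ∃ θ : HeckeCharacter L, θ.IsFiniteOrder ∧ θ.localComponent w (-1) = -1 ∧ θ.localComponent w' = 1 := by
  classical
  obtain ⟨θw, hopen, hfin, -, -, hneg⟩ := LemD1IndexedNonVacuityTameTwist.exists_tame_character w h2
  obtain ⟨θ, hθfin, hθw⟩ :=
    GaloisRepresentations.ClozelHarrisTaylor2008.exists_heckeCharacter_isFiniteOrder_localComponent_eq {w, w'}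
      (Function.update (fun w'' : HeightOneSpectrum (𝓞 L) => (1 : (w''.adicCompletion L)ˣ →* ℂˣ)) w θw) (fun u hu => by
        rw [Finset.mem_insert, Finset.mem_singleton] at hu
        rcases hu with rfl | rfl
        · rw [Function.update_self]; exact ⟨hopen, hfin⟩
        · rw [Function.update_of_ne hww']
          exact ⟨by rw [MonoidHom.ker_one]; exact isOpen_univ, IsOfFinOrder.one⟩)
  have hw : θ.localComponent w = θw := by
    rw [hθw w (Finset.mem_insert_self _ _), Function.update_self]
  have hw' : θ.localComponent w' = 1 := by
    rw [hθw w' (Finset.mem_insert_of_mem (Finset.mem_singleton_self _)), Function.update_of_ne hww']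
  have hsq : θw (-1) = -1 := by
    have h1 : θw (-1) ^ 2 = 1 := by rw [← map_pow, neg_one_sq, map_one]
    have h2' : (((θw (-1) : ℂˣ) : ℂ)) ^ 2 = 1 := by rw [← Units.val_pow_eq_pow_val, h1, Units.val_one]
    rcases sq_eq_one_iff.1 h2' with h | h
    · exact absurd (Units.ext h) hneg
    · exact Units.ext (by rw [h, Units.val_neg, Units.val_one])
  exact ⟨θ, hθfin, by rw [hw]; exact hsq, hw'⟩

open scoped Classical in
/-- **the local effect of the twist on a unit concentrated at ONE place `w ∣ v`**: for the unit `z = (x at w, 1 elsewhere)` of `L_v`,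
`localMu L (χ · θ · (θ ∘ c)⁻¹) v z = localMu L χ v z · θ_w(x) · θ_{c w}(c_w x)⁻¹` (`c • ⟨x⟩_w = ⟨c_w x⟩_{c w}`; at the places `≠ w` the
component of `z` is `1`). [cite: Liu2021, Def. 4.11 (l. 2086)] [cite: CasselsFrohlichANT1967, Ch. VII §1.1] -/
theorem localMu_mul_twist_apply_single (χ θ : HeckeCharacter L) (w : PlacesOver L v) (x : (w.1.adicCompletion L)ˣ) :
    localMu L (χ * (θ * (HeckeCharacter.galConj cc θ)⁻¹)) v
        (MulEquiv.piUnits.symm (Pi.mulSingle w x : ∀ w' : PlacesOver L v, (w'.1.adicCompletion L)ˣ)) =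
      localMu L χ v (MulEquiv.piUnits.symm (Pi.mulSingle w x : ∀ w' : PlacesOver L v, (w'.1.adicCompletion L)ˣ)) *
        (θ.localComponent w.1 x *
          (θ.localComponent (cc • w.1) (galAdicCompletionUnitsEquiv (L := L) cc rfl x))⁻¹) := by
  classical
  set z : (LocalRing L v)ˣ := MulEquiv.piUnits.symm (Pi.mulSingle w x : ∀ w' : PlacesOver L v, (w'.1.adicCompletion L)ˣ) with hz
  have hzw : ∀ w' : PlacesOver L v,
      Units.map (Pi.evalMonoidHom (fun w'' : PlacesOver L v => w''.1.adicCompletion L) w') z =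
        (Pi.mulSingle w x : ∀ w' : PlacesOver L v, (w'.1.adicCompletion L)ˣ) w' := fun w' => Units.ext rfl
  have key : ∀ η : HeckeCharacter L, localMu L η v z = η (localUnits w.1 x) := by
    intro η
    rw [localMu_apply, Finset.prod_eq_single w]
    · rw [hzw, Pi.mulSingle_eq_same]
    · intro w' _ hw'
      rw [hzw, Pi.mulSingle_eq_of_ne hw', map_one, map_one]
    · intro h; exact absurd (Finset.mem_univ w) h
  rw [localMu_mul, localMu_mul, localMu_inv, MonoidHom.mul_apply, MonoidHom.mul_apply, MonoidHom.inv_apply, key θ,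
    key (HeckeCharacter.galConj cc θ), HeckeCharacter.galConj_apply, smul_localUnits_eq L cc rfl,
    HeckeCharacter.localComponent_apply, HeckeCharacter.localComponent_apply]

open scoped Classical in
/-- **MAIN at a SPLIT place**: for `v ∤ 2` of `L⁺`, `w ∣ v` with `c • w ≠ w`, and a conjugate symplectic `ψ` ([Liu2021, Def. 4.1]) of
∞-type `e`, there is a conjugate symplectic `ψ'` of ∞-type `e` whose μ-label at `v` takes the value `−(μ-label of ψ)` at the unit
`z = (−1 at w, 1 at c w)` of `L_v` (`ψ' = ψ · θ̃ · (θ̃ ∘ c)⁻¹` for the finite-order `θ` with `θ_w` tame, `θ_w(−1) = −1`, and `θ_{c w} = 1`);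
in particular the two labels DIFFER.  (At a split place a second LOCAL label was in the tree, `…AtPlace` §3; the same-∞-type GLOBAL
companion is new.) [cite: Liu2021, App. D §D.1 Step 2 (l. 5219), Def. 4.1 (l. 1900–1902), Def. 4.11 (l. 2086)]
[cite: ClozelHarrisTaylor2008, Lemma 4.1.1 (p. 116)] -/
theorem exists_isConjugateSymplectic_localMu_apply_single_eq_neg_of_split (h2 : (2 : 𝓞 L⁺) ∉ v.asIdeal) (w : PlacesOver L v)
    (hw : cc • w.1 ≠ w.1) (ψ : IdeleClassGroup L →ₜ* Circle) (hψ : IsConjugateSymplectic L ψ) {e : InfinitePlace L → ℤ}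
    (he : HasInfinityType L ψ e) :
    ∃ ψ' : IdeleClassGroup L →ₜ* Circle, IsConjugateSymplectic L ψ' ∧ HasInfinityType L ψ' e ∧
      localMu L (toHeckeCharacter L ψ') v
          (MulEquiv.piUnits.symm (Pi.mulSingle w (-1) : ∀ w' : PlacesOver L v, (w'.1.adicCompletion L)ˣ)) =
        -localMu L (toHeckeCharacter L ψ) v
          (MulEquiv.piUnits.symm (Pi.mulSingle w (-1) : ∀ w' : PlacesOver L v, (w'.1.adicCompletion L)ˣ)) ∧
      localMu L (toHeckeCharacter L ψ') v ≠ localMu L (toHeckeCharacter L ψ) v := by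
  classical
  obtain ⟨θ, hθfin, hθneg, hθ'⟩ := exists_heckeCharacter_isFiniteOrder_tame_and_trivial L w.1 (cc • w.1) hw
    (LemD1IndexedNonVacuityTameTwist.two_not_mem_of_placesOver L v w h2)
  obtain ⟨ψ', hψ', he', hH⟩ := exists_twist_of_isFiniteOrder L hθfin ψ hψ he
  have key : localMu L (toHeckeCharacter L ψ') v
        (MulEquiv.piUnits.symm (Pi.mulSingle w (-1) : ∀ w' : PlacesOver L v, (w'.1.adicCompletion L)ˣ)) =
      -localMu L (toHeckeCharacter L ψ) v
        (MulEquiv.piUnits.symm (Pi.mulSingle w (-1) : ∀ w' : PlacesOver L v, (w'.1.adicCompletion L)ˣ)) := by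
    rw [hH, localMu_mul_twist_apply_single L v _ θ w, hθneg, hθ', MonoidHom.one_apply, inv_one, mul_one, mul_neg, mul_one]
  refine ⟨ψ', hψ', he', key, fun h => ?_⟩
  rw [h] at key
  have := Units.ext_iff.1 key
  rw [Units.val_neg] at this
  exact (localMu L (toHeckeCharacter L ψ) v _).ne_zero (by linear_combination (1 : ℂ) / 2 * this)

/-- **SYNTHESIS — at EVERY place `v ∤ 2` of `L⁺`, split or not**: for every conjugate symplectic `ψ` of ∞-type `e` there is a conjugate
symplectic `ψ'` of the SAME ∞-type whose μ-label `localMu L (toHeckeCharacter L ψ') v` differs from that of `ψ` (non-split: §4; split: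
§6): the μ-conjunct of the `hD3` row distinguishes two members of the displayed family at EVERY prescribed place `∤ 2`.
[cite: Liu2021, App. D §D.1 Step 2 (l. 5219), Lemma D.1 (3) (l. 5233), Def. 4.1 (l. 1900–1902)] -/
theorem exists_isConjugateSymplectic_localMu_ne (h2 : (2 : 𝓞 L⁺) ∉ v.asIdeal) (ψ : IdeleClassGroup L →ₜ* Circle)
    (hψ : IsConjugateSymplectic L ψ) {e : InfinitePlace L → ℤ} (he : HasInfinityType L ψ e) :
    ∃ ψ' : IdeleClassGroup L →ₜ* Circle, IsConjugateSymplectic L ψ' ∧ HasInfinityType L ψ' e ∧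
      localMu L (toHeckeCharacter L ψ') v ≠ localMu L (toHeckeCharacter L ψ) v := by
  obtain ⟨w⟩ := (inferInstance : Nonempty (PlacesOver L v))
  by_cases hw : cc • w.1 = w.1
  · obtain ⟨ψ', hψ', he', -, hne⟩ := exists_isConjugateSymplectic_localMu_apply_eps_eq_neg L v h2 w hw ψ hψ he
    exact ⟨ψ', hψ', he', hne⟩
  · obtain ⟨ψ', hψ', he', -, hne⟩ := exists_isConjugateSymplectic_localMu_apply_single_eq_neg_of_split L v h2 w hw ψ hψ he
    exact ⟨ψ', hψ', he', hne⟩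

/-- **the packaged `hD3` labels differ at EVERY prescribed place `v ∤ 2`** (split or not), for a companion `ψ'` of the same ∞-type:
`LemD1OfPlace.muOf (localMu … ψ' …) ≠ LemD1OfPlace.muOf (localMu … ψ …)` with VERBATIM the rows' displayed side proofs.
[cite: Liu2021, App. D §D.1 Step 2 (l. 5219), Lemma D.1 (3) (l. 5233)] -/
theorem exists_isConjugateSymplectic_muOf_localMu_ne' (h2 : (2 : 𝓞 L⁺) ∉ v.asIdeal) (ψ : IdeleClassGroup L →ₜ* Circle)
    (hψ : IsConjugateSymplectic L ψ) {e : InfinitePlace L → ℤ} (he : HasInfinityType L ψ e) :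
    ∃ (ψ' : IdeleClassGroup L →ₜ* Circle) (hψ' : IsConjugateSymplectic L ψ'), HasInfinityType L ψ' e ∧
      LemD1OfPlace.muOf L v cc N J (complexConj_imagUnit L) (imagUnit_ne_zero L) hN hJh hJdet
          (localMu L (toHeckeCharacter L ψ') v)
          (fun x => norm_localMu L (toHeckeCharacter L ψ') v (isUnitary_toHeckeCharacter L ψ') x)
          (continuous_localMu L (toHeckeCharacter L ψ') v)
          (fun t => localMu_toLocalRing_eq_one_iff L (toHeckeCharacter L ψ') v
            ((isOscillatorChar_toHeckeCharacter_iff ψ').mpr hψ') t) ≠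
        LemD1OfPlace.muOf L v cc N J (complexConj_imagUnit L) (imagUnit_ne_zero L) hN hJh hJdet
          (localMu L (toHeckeCharacter L ψ) v)
          (fun x => norm_localMu L (toHeckeCharacter L ψ) v (isUnitary_toHeckeCharacter L ψ) x)
          (continuous_localMu L (toHeckeCharacter L ψ) v)
          (fun t => localMu_toLocalRing_eq_one_iff L (toHeckeCharacter L ψ) v
            ((isOscillatorChar_toHeckeCharacter_iff ψ).mpr hψ) t) := by
  obtain ⟨ψ', hψ', he', hne⟩ := exists_isConjugateSymplectic_localMu_ne L v h2 ψ hψ he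
  exact ⟨ψ', hψ', he', fun h => hne (congrArg Subtype.val h)⟩

end Literature.NumberTheory.Automorphic.Liu2021.LemD1IndexedNonVacuityTameTwistCM

end
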